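import Summits.AnomalousDissipation.AnomalousDissipation.Theorems.SolenoidalFractalHomogenisationRealisedQuasiStaticCellLawSlavedPairSlow
import HarnessLib

/-!
# K2R `RealisedQuasiStaticCellLaw`, line `floquet-bloch`, stub `stub_lowSectorDecay` (S1D): the slaved PAIR of ladders with
# a joint slow quadratic form, II — the pointwise Lyapunov inequality at a constant target rate

Summits-side helper file (everything proved; no definitions, no named facts; `--supports stmt-AnomalousDissipation-20446`).
The slaving functional of `…SlavedLadder` gives each polarisation block of a principal coset its own (anisotropic) slaved
rate; the crux rate for the Taylor sectors `|ℓ′| = O(1)` is the ISOTROPIC slot sum, which no single polarisation realises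
slot by slot. Device (co-moving slow metric): measure the slow pair `y = (v¹₀, v²₀)` (out-of-plane / in-plane slow entries
of the two ladders of one coset, same `W, d, Λ, g`, links `s¹, s²`) in a time-dependent Hermitian form
`S = a|y₁|² + b|y₂|² + 2Re(c ȳ₁ y₂)` whose weights absorb the difference between the instantaneous nominal slaved rates
`λ_k = Λ(d₀ + g²σ_k)` and a CONSTANT target rate `λ̄`: `a' = 2(λ₁−λ̄)a`, `b' = 2(λ₂−λ̄)b`, `c' = (λ₁+λ₂−2λ̄)c`
(over a period this is `G(t) = e^{−2λ̄t} U(t)^{−*}U(t)^{−1}` for the nominal slow propagator `U`). Then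
`Φ = S + β(F¹ + F²)` (`F^k` the fast remainders of `…SlavedLadderFast`) obeys `Φ' ≤ −2((1−ε)λ̄ − μ₀)Φ`
(`slavedPair_pointwise`) when `16G_max² g_T² Λ γ² ≤ G_min ε λ̄ β Δ`, `g_T²·4γ²/Δ + 2λ̄/Λ ≤ Δ`, with the slack
`μ₀ = 4βγ²(Λg_T³σ + g_D + Λg_T²)²/(G_min ΛΔ³)` (`σ = max σ_k`, `G_min ≤ S/|y|²`, `a, b, |c| ≤ G_max`). The identity
`slow_field_eq` isolates the exact slaved slow field `Fv₀ = −λ_k x₀ − gΛX` with `‖X‖ ≤ γ√F`.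
-/

set_option linter.dupNamespace false

namespace Summit.AnomalousDissipation.AnomalousDissipation.Theorems.SolenoidalFractalHomogenisation.RealisedQuasiStaticCellLaw

noncomputable section

open Set Finset Complex
open scoped BigOperators ComplexConjugate

/-! ## §2 The pointwise inequality for the pair with a joint slow form -/

/-- **Slaved pair, pointwise form.** Two ladders (`k = 1, 2`: states `x₁, x₂`, links `s₁, s₂`, same `W, d, Λ`, coupling
value `gt`, derivative `gdt`), their fields `Fv₁, Fv₂`, profiles `hf₁, hf₂` and profile derivatives `hd₁, hd₂`; a joint
slow form with weights `a, b : ℝ`, `c : ℂ` (`G_min(|y₁|²+|y₂|²) ≤ S`, `a, b, |c| ≤ G_max`) and weight derivatives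
`2(λ₁−λ̄)a`, `2(λ₂−λ̄)b`, `(λ₁+λ₂−2λ̄)c`, `λ_k = Λ(d₀ + gt²σ_k)`. Then
`S' + β(F₁' + F₂') + 2((1−ε)λ̄ − μ₀)(S + β(F₁+F₂)) ≤ 0`. -/
theorem slavedPair_pointwise (W : Finset ℤ) (h1 : (1 : ℤ) ∈ W) (hm1 : (-1 : ℤ) ∈ W)
    (d s₁ s₂ : ℤ → ℝ) (Λ gT gD Δ γ σ₁ σ₂ σ ε β gt gdt lam Gmax Gmin a b : ℝ) (c : ℂ)
    (x₁ x₂ Fv₁ Fv₂ : ℤ → ℂ) (hf₁ hd₁ hf₂ hd₂ : ℤ → ℝ)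
    (hs₁ : ∀ J ∈ W, |s₁ J| ≤ 1) (hs₂ : ∀ J ∈ W, |s₂ J| ≤ 1)
    (hγ₁ : s₁ 0 ^ 2 + s₁ (-1) ^ 2 ≤ γ ^ 2) (hγ₂ : s₂ 0 ^ 2 + s₂ (-1) ^ 2 ≤ γ ^ 2) (hγ0 : 0 ≤ γ)
    (hσ₁ : σ₁ = s₁ (-1) ^ 2 / (d (-1) - d 0) + s₁ 0 ^ 2 / (d 1 - d 0))
    (hσ₂ : σ₂ = s₂ (-1) ^ 2 / (d (-1) - d 0) + s₂ 0 ^ 2 / (d 1 - d 0))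
    (hσ₁le : σ₁ ≤ σ) (hσ₂le : σ₂ ≤ σ)
    (hΔ0 : 0 < Δ) (hΔ : ∀ J ∈ W, J ≠ 0 → d 0 + Δ ≤ d J) (hd0 : 0 ≤ d 0) (hΛ : 0 < Λ) (hε : 0 ≤ ε) (hβ : 0 ≤ β)
    (hlam : 0 ≤ lam) (hGmin : 0 < Gmin) (hGmax : a ≤ Gmax ∧ b ≤ Gmax ∧ ‖c‖ ≤ Gmax)
    (hG : ∀ y₁ y₂ : ℂ, Gmin * (‖y₁‖ ^ 2 + ‖y₂‖ ^ 2) ≤ a * ‖y₁‖ ^ 2 + b * ‖y₂‖ ^ 2 + 2 * (c * conj y₁ * y₂).re)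
    (hβ' : 16 * Gmax ^ 2 * gT ^ 2 * Λ * γ ^ 2 ≤ Gmin * ε * lam * β * Δ)
    (hgt : |gt| ≤ gT) (hgdt : |gdt| ≤ gD)
    (hsmall : gT ^ 2 * (4 * γ ^ 2 / Δ) + 2 * lam / Λ ≤ Δ)
    (hx₁ : ∀ K, K ∉ W → x₁ K = 0) (hx₂ : ∀ K, K ∉ W → x₂ K = 0)
    (hFv₁ : ∀ J, Fv₁ J = -(Λ : ℂ) * ((d J : ℂ) * x₁ J) -
      (gt : ℂ) * (Λ : ℂ) * ((s₁ (J - 1) : ℂ) * x₁ (J - 1) - (s₁ J : ℂ) * x₁ (J + 1)))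
    (hFv₂ : ∀ J, Fv₂ J = -(Λ : ℂ) * ((d J : ℂ) * x₂ J) -
      (gt : ℂ) * (Λ : ℂ) * ((s₂ (J - 1) : ℂ) * x₂ (J - 1) - (s₂ J : ℂ) * x₂ (J + 1)))
    (hhf₁ : ∀ J, hf₁ J = if J = 1 then -(gt * s₁ 0 / (d 1 - d 0))
      else if J = -1 then gt * s₁ (-1) / (d (-1) - d 0) else 0)
    (hhd₁ : ∀ J, hd₁ J = if J = 1 then -(gdt * s₁ 0 / (d 1 - d 0))
      else if J = -1 then gdt * s₁ (-1) / (d (-1) - d 0) else 0)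
    (hhf₂ : ∀ J, hf₂ J = if J = 1 then -(gt * s₂ 0 / (d 1 - d 0))
      else if J = -1 then gt * s₂ (-1) / (d (-1) - d 0) else 0)
    (hhd₂ : ∀ J, hd₂ J = if J = 1 then -(gdt * s₂ 0 / (d 1 - d 0))
      else if J = -1 then gdt * s₂ (-1) / (d (-1) - d 0) else 0) :
    ((2 * (Λ * (d 0 + gt ^ 2 * σ₁) - lam) * a) * ‖x₁ 0‖ ^ 2 + (2 * (Λ * (d 0 + gt ^ 2 * σ₂) - lam) * b) * ‖x₂ 0‖ ^ 2 +
        2 * ((((Λ * (d 0 + gt ^ 2 * σ₁) + Λ * (d 0 + gt ^ 2 * σ₂) - 2 * lam : ℝ) : ℂ) * c) * conj (x₁ 0) * x₂ 0).re +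
      (a * (2 * (Fv₁ 0 * conj (x₁ 0)).re) + b * (2 * (Fv₂ 0 * conj (x₂ 0)).re) +
        2 * (c * conj (Fv₁ 0) * x₂ 0 + c * conj (x₁ 0) * Fv₂ 0).re)) +
      β * (∑ J ∈ W.erase 0,
          2 * ((Fv₁ J - ((hd₁ J : ℂ) * x₁ 0 + (hf₁ J : ℂ) * Fv₁ 0)) * conj (x₁ J - (hf₁ J : ℂ) * x₁ 0)).re +
        ∑ J ∈ W.erase 0,
          2 * ((Fv₂ J - ((hd₂ J : ℂ) * x₂ 0 + (hf₂ J : ℂ) * Fv₂ 0)) * conj (x₂ J - (hf₂ J : ℂ) * x₂ 0)).re) +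
      (2 * ((1 - ε) * lam) - 2 * (4 * β * γ ^ 2 * (Λ * gT ^ 3 * σ + gD + Λ * gT ^ 2) ^ 2 / (Gmin * Λ * Δ ^ 3))) *
        ((a * ‖x₁ 0‖ ^ 2 + b * ‖x₂ 0‖ ^ 2 + 2 * (c * conj (x₁ 0) * x₂ 0).re) +
          β * (∑ J ∈ W.erase 0, ‖x₁ J - (hf₁ J : ℂ) * x₁ 0‖ ^ 2 + ∑ J ∈ W.erase 0, ‖x₂ J - (hf₂ J : ℂ) * x₂ 0‖ ^ 2)) ≤ 0 := by
  classical
  have hδp0 : 0 < d 1 - d 0 := by linarith [hΔ 1 h1 (by norm_num)]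
  have hδm0 : 0 < d (-1) - d 0 := by linarith [hΔ (-1) hm1 (by norm_num)]
  have hσ₁0 : 0 ≤ σ₁ := by rw [hσ₁]; positivity
  have hσ₂0 : 0 ≤ σ₂ := by rw [hσ₂]; positivity
  have hσ0 : 0 ≤ σ := hσ₁0.trans hσ₁le
  have hgT0 : 0 ≤ gT := (abs_nonneg _).trans hgt
  have hgD0 : 0 ≤ gD := (abs_nonneg _).trans hgdt
  have hgt2 : gt ^ 2 ≤ gT ^ 2 := by rw [← sq_abs]; exact pow_le_pow_left₀ (abs_nonneg _) hgt 2
  obtain ⟨hGa, hGb, hGc⟩ := hGmax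
  have hGmax0 : 0 ≤ Gmax := (norm_nonneg c).trans hGc
  -- per-ladder `γ_k`
  obtain ⟨γ₁, hγ₁def⟩ : ∃ γ₁ : ℝ, γ₁ = Real.sqrt (s₁ 0 ^ 2 + s₁ (-1) ^ 2) := ⟨_, rfl⟩
  obtain ⟨γ₂, hγ₂def⟩ : ∃ γ₂ : ℝ, γ₂ = Real.sqrt (s₂ 0 ^ 2 + s₂ (-1) ^ 2) := ⟨_, rfl⟩
  have hγ₁sq : γ₁ ^ 2 = s₁ 0 ^ 2 + s₁ (-1) ^ 2 := by rw [hγ₁def]; exact Real.sq_sqrt (by positivity)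
  have hγ₂sq : γ₂ ^ 2 = s₂ 0 ^ 2 + s₂ (-1) ^ 2 := by rw [hγ₂def]; exact Real.sq_sqrt (by positivity)
  have hγ₁0 : 0 ≤ γ₁ := by rw [hγ₁def]; exact Real.sqrt_nonneg _
  have hγ₂0 : 0 ≤ γ₂ := by rw [hγ₂def]; exact Real.sqrt_nonneg _
  have hγ₁le : γ₁ ≤ γ := by rw [hγ₁def, ← Real.sqrt_sq hγ0]; exact Real.sqrt_le_sqrt hγ₁
  have hγ₂le : γ₂ ≤ γ := by rw [hγ₂def, ← Real.sqrt_sq hγ0]; exact Real.sqrt_le_sqrt hγ₂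
  -- energies and sizes
  obtain ⟨F₁, hF₁def⟩ : ∃ F : ℝ, F = ∑ J ∈ W.erase 0, ‖x₁ J - (hf₁ J : ℂ) * x₁ 0‖ ^ 2 := ⟨_, rfl⟩
  obtain ⟨F₂, hF₂def⟩ : ∃ F : ℝ, F = ∑ J ∈ W.erase 0, ‖x₂ J - (hf₂ J : ℂ) * x₂ 0‖ ^ 2 := ⟨_, rfl⟩
  have hF₁0 : 0 ≤ F₁ := by rw [hF₁def]; exact Finset.sum_nonneg fun J _ => by positivity
  have hF₂0 : 0 ≤ F₂ := by rw [hF₂def]; exact Finset.sum_nonneg fun J _ => by positivity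
  obtain ⟨Y₁, hY₁def⟩ : ∃ Y : ℝ, Y = Real.sqrt F₁ := ⟨_, rfl⟩
  obtain ⟨Y₂, hY₂def⟩ : ∃ Y : ℝ, Y = Real.sqrt F₂ := ⟨_, rfl⟩
  have hY₁0 : 0 ≤ Y₁ := by rw [hY₁def]; exact Real.sqrt_nonneg _
  have hY₂0 : 0 ≤ Y₂ := by rw [hY₂def]; exact Real.sqrt_nonneg _
  have hY₁sq : Y₁ ^ 2 = F₁ := by rw [hY₁def]; exact Real.sq_sqrt hF₁0
  have hY₂sq : Y₂ ^ 2 = F₂ := by rw [hY₂def]; exact Real.sq_sqrt hF₂0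
  obtain ⟨V₁, hV₁def⟩ : ∃ V : ℝ, V = ‖x₁ 0‖ := ⟨_, rfl⟩
  obtain ⟨V₂, hV₂def⟩ : ∃ V : ℝ, V = ‖x₂ 0‖ := ⟨_, rfl⟩
  have hV₁0 : 0 ≤ V₁ := by rw [hV₁def]; exact norm_nonneg _
  have hV₂0 : 0 ≤ V₂ := by rw [hV₂def]; exact norm_nonneg _
  obtain ⟨S, hSdef⟩ : ∃ S : ℝ, S = a * ‖x₁ 0‖ ^ 2 + b * ‖x₂ 0‖ ^ 2 + 2 * (c * conj (x₁ 0) * x₂ 0).re := ⟨_, rfl⟩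
  have hSmin : Gmin * (V₁ ^ 2 + V₂ ^ 2) ≤ S := by rw [hSdef, hV₁def, hV₂def]; exact hG (x₁ 0) (x₂ 0)
  have hN0 : 0 ≤ V₁ ^ 2 + V₂ ^ 2 := by positivity
  have hS0 : 0 ≤ S := (mul_nonneg hGmin.le hN0).trans hSmin
  obtain ⟨cB, hcBdef⟩ : ∃ cB : ℝ, cB = γ * (Λ * gT ^ 3 * σ + gD + Λ * gT ^ 2) / Δ := ⟨_, rfl⟩
  have hcB0 : 0 ≤ cB := by rw [hcBdef]; positivity
  obtain ⟨μ₀, hμ₀def⟩ : ∃ μ₀ : ℝ, μ₀ = 4 * β * γ ^ 2 * (Λ * gT ^ 3 * σ + gD + Λ * gT ^ 2) ^ 2 / (Gmin * Λ * Δ ^ 3) :=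
    ⟨_, rfl⟩
  have hμ₀0 : 0 ≤ μ₀ := by rw [hμ₀def]; positivity
  have hμ₀cB : μ₀ * (Gmin * Λ * Δ) = 4 * β * cB ^ 2 := by
    rw [hμ₀def, hcBdef]; field_simp
  -- (A) the slow form (file `…SlavedPairSlow`)
  have ha0 : 0 ≤ a := by have := hG 1 0; simp at this; linarith
  have hb0 : 0 ≤ b := by have := hG 0 1; simp at this; linarith
  have hslow := slavedPair_slow_le W h1 hm1 d s₁ s₂ Λ γ σ₁ σ₂ gt lam Gmax a b c x₁ x₂ (Fv₁ 0) (Fv₂ 0) hf₁ hf₂ hγ₁ hγ₂ hγ0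
    hσ₁ hσ₂ hΛ ha0 hb0 ⟨hGa, hGb, hGc⟩ (hFv₁ 0) (hFv₂ 0) hhf₁ hhf₂
  rw [← hSdef, ← hF₁def, ← hF₂def, ← hY₁def, ← hY₂def, ← hV₁def, ← hV₂def] at hslow
  ------------------------------------------------------------------
  -- (B) the fast remainders (file `…SlavedLadderFast`)
  ------------------------------------------------------------------
  have hfast₁ := slavedLadder_fast_le W h1 hm1 d s₁ Λ gT gD Δ γ₁ σ₁ gt gdt x₁ Fv₁ hf₁ hd₁ hs₁ hγ₁sq hγ₁0 hσ₁ hΔ0 hΔ hΛ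
    hgt hgdt hx₁ hFv₁ hhf₁ hhd₁
  have hfast₂ := slavedLadder_fast_le W h1 hm1 d s₂ Λ gT gD Δ γ₂ σ₂ gt gdt x₂ Fv₂ hf₂ hd₂ hs₂ hγ₂sq hγ₂0 hσ₂ hΔ0 hΔ hΛ
    hgt hgdt hx₂ hFv₂ hhf₂ hhd₂
  rw [← hF₁def, ← hV₁def, ← hY₁def] at hfast₁
  rw [← hF₂def, ← hV₂def, ← hY₂def] at hfast₂
  -- compare the per-ladder constants with the common ones
  have hcB₁ : γ₁ * (Λ * gT ^ 3 * σ₁ + gD + Λ * gT ^ 2) / Δ ≤ cB := by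
    rw [hcBdef]
    refine div_le_div_of_nonneg_right ?_ hΔ0.le
    exact mul_le_mul hγ₁le (by have := mul_le_mul_of_nonneg_left hσ₁le (by positivity : 0 ≤ Λ * gT ^ 3); linarith only [this])
      (by positivity) hγ0
  have hcB₂ : γ₂ * (Λ * gT ^ 3 * σ₂ + gD + Λ * gT ^ 2) / Δ ≤ cB := by
    rw [hcBdef]
    refine div_le_div_of_nonneg_right ?_ hΔ0.le
    exact mul_le_mul hγ₂le (by have := mul_le_mul_of_nonneg_left hσ₂le (by positivity : 0 ≤ Λ * gT ^ 3); linarith only [this])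
      (by positivity) hγ0
  have hγ₁F : 4 * (Λ * gT ^ 2 * γ₁ ^ 2 * F₁ / Δ) ≤ 4 * (Λ * gT ^ 2 * γ ^ 2 * F₁ / Δ) := by
    have : γ₁ ^ 2 ≤ γ ^ 2 := pow_le_pow_left₀ hγ₁0 hγ₁le 2
    have h2 := mul_le_mul_of_nonneg_right (mul_le_mul_of_nonneg_left this (by positivity : 0 ≤ Λ * gT ^ 2)) hF₁0
    have h3 := div_le_div_of_nonneg_right h2 hΔ0.le
    linarith only [h3]
  have hγ₂F : 4 * (Λ * gT ^ 2 * γ₂ ^ 2 * F₂ / Δ) ≤ 4 * (Λ * gT ^ 2 * γ ^ 2 * F₂ / Δ) := by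
    have : γ₂ ^ 2 ≤ γ ^ 2 := pow_le_pow_left₀ hγ₂0 hγ₂le 2
    have h2 := mul_le_mul_of_nonneg_right (mul_le_mul_of_nonneg_left this (by positivity : 0 ≤ Λ * gT ^ 2)) hF₂0
    have h3 := div_le_div_of_nonneg_right h2 hΔ0.le
    linarith only [h3]
  have hfast₁' : ∑ J ∈ W.erase 0,
      2 * ((Fv₁ J - ((hd₁ J : ℂ) * x₁ 0 + (hf₁ J : ℂ) * Fv₁ 0)) * conj (x₁ J - (hf₁ J : ℂ) * x₁ 0)).re ≤
      -2 * Λ * (d 0 + Δ) * F₁ + 4 * (V₁ * Y₁ * cB) + 4 * (Λ * gT ^ 2 * γ ^ 2 * F₁ / Δ) := by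
    have t := mul_le_mul_of_nonneg_left hcB₁ (by positivity : 0 ≤ 4 * (V₁ * Y₁))
    have e : 4 * (V₁ * Y₁ * (γ₁ * (Λ * gT ^ 3 * σ₁ + gD + Λ * gT ^ 2) / Δ)) =
        4 * (V₁ * Y₁) * (γ₁ * (Λ * gT ^ 3 * σ₁ + gD + Λ * gT ^ 2) / Δ) := by ring
    have e' : 4 * (V₁ * Y₁) * cB = 4 * (V₁ * Y₁ * cB) := by ring
    linarith only [hfast₁, t, hγ₁F, e, e']
  have hfast₂' : ∑ J ∈ W.erase 0,
      2 * ((Fv₂ J - ((hd₂ J : ℂ) * x₂ 0 + (hf₂ J : ℂ) * Fv₂ 0)) * conj (x₂ J - (hf₂ J : ℂ) * x₂ 0)).re ≤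
      -2 * Λ * (d 0 + Δ) * F₂ + 4 * (V₂ * Y₂ * cB) + 4 * (Λ * gT ^ 2 * γ ^ 2 * F₂ / Δ) := by
    have t := mul_le_mul_of_nonneg_left hcB₂ (by positivity : 0 ≤ 4 * (V₂ * Y₂))
    have e : 4 * (V₂ * Y₂ * (γ₂ * (Λ * gT ^ 3 * σ₂ + gD + Λ * gT ^ 2) / Δ)) =
        4 * (V₂ * Y₂) * (γ₂ * (Λ * gT ^ 3 * σ₂ + gD + Λ * gT ^ 2) / Δ) := by ring
    have e' : 4 * (V₂ * Y₂) * cB = 4 * (V₂ * Y₂ * cB) := by ring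
    linarith only [hfast₂, t, hγ₂F, e, e']
  ------------------------------------------------------------------
  -- (C) assembling: variables `n₀² = V₁² + V₂²`, `F = F₁ + F₂`
  ------------------------------------------------------------------
  -- Cauchy–Schwarz reductions
  have hVY : (V₁ + V₂) * (Y₁ + Y₂) ≤ 2 * (Real.sqrt (V₁ ^ 2 + V₂ ^ 2) * Real.sqrt (F₁ + F₂)) := by
    have h1' : V₁ + V₂ ≤ Real.sqrt 2 * Real.sqrt (V₁ ^ 2 + V₂ ^ 2) := by
      rw [← Real.sqrt_mul (by norm_num), ← Real.sqrt_sq (by positivity : 0 ≤ V₁ + V₂)]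
      exact Real.sqrt_le_sqrt (by linarith only [sq_nonneg (V₁ - V₂)])
    have h2' : Y₁ + Y₂ ≤ Real.sqrt 2 * Real.sqrt (F₁ + F₂) := by
      rw [← Real.sqrt_mul (by norm_num), ← Real.sqrt_sq (by positivity : 0 ≤ Y₁ + Y₂)]
      exact Real.sqrt_le_sqrt (by rw [← hY₁sq, ← hY₂sq]; linarith only [sq_nonneg (Y₁ - Y₂)])
    have h3 := mul_le_mul h1' h2' (by positivity) (by positivity)
    have e : Real.sqrt 2 * Real.sqrt (V₁ ^ 2 + V₂ ^ 2) * (Real.sqrt 2 * Real.sqrt (F₁ + F₂)) =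
        (Real.sqrt 2 * Real.sqrt 2) * (Real.sqrt (V₁ ^ 2 + V₂ ^ 2) * Real.sqrt (F₁ + F₂)) := by ring
    rw [e, Real.mul_self_sqrt (by norm_num)] at h3
    exact h3
  have hVYcB : V₁ * Y₁ + V₂ * Y₂ ≤ Real.sqrt (V₁ ^ 2 + V₂ ^ 2) * Real.sqrt (F₁ + F₂) := by
    rw [← Real.sqrt_mul hN0]
    have h0 : 0 ≤ V₁ * Y₁ + V₂ * Y₂ := by positivity
    rw [← Real.sqrt_sq h0]
    exact Real.sqrt_le_sqrt (by rw [← hY₁sq, ← hY₂sq]; linarith only [sq_nonneg (V₁ * Y₂ - V₂ * Y₁)])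
  obtain ⟨nV, hnV⟩ : ∃ nV : ℝ, nV = Real.sqrt (V₁ ^ 2 + V₂ ^ 2) := ⟨_, rfl⟩
  obtain ⟨Y, hY⟩ : ∃ Y : ℝ, Y = Real.sqrt (F₁ + F₂) := ⟨_, rfl⟩
  have hnV0 : 0 ≤ nV := by rw [hnV]; exact Real.sqrt_nonneg _
  have hY0 : 0 ≤ Y := by rw [hY]; exact Real.sqrt_nonneg _
  have hnVsq : nV ^ 2 = V₁ ^ 2 + V₂ ^ 2 := by rw [hnV]; exact Real.sq_sqrt hN0
  have hYsq : Y ^ 2 = F₁ + F₂ := by rw [hY]; exact Real.sq_sqrt (by positivity)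
  rw [← hnV, ← hY] at hVY hVYcB
  have hSn : Gmin * nV ^ 2 ≤ S := by rw [hnVsq]; exact hSmin
  -- AM–GM 1: slow forcing against `ε lam Gmin nV²` and half the fast dissipation
  have hAG1 : 2 * (4 * |gt| * Λ * Gmax * γ * (nV * Y)) ≤ 2 * ε * lam * Gmin * nV ^ 2 + β * Λ * Δ * Y ^ 2 / 2 := by
    have hP : 0 ≤ 2 * ε * lam * Gmin * nV ^ 2 :=
      mul_nonneg (mul_nonneg (mul_nonneg (mul_nonneg zero_le_two hε) hlam) hGmin.le) (sq_nonneg _)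
    have hQ : 0 ≤ β * Λ * Δ * Y ^ 2 / 2 :=
      div_nonneg (mul_nonneg (mul_nonneg (mul_nonneg hβ hΛ.le) hΔ0.le) (sq_nonneg Y)) zero_le_two
    refine two_mul_le_add_of_sq_le_mul hP hQ ?_
    have e1 : (4 * |gt| * Λ * Gmax * γ * (nV * Y)) ^ 2 = (16 * Gmax ^ 2 * gt ^ 2 * Λ * γ ^ 2) * (Λ * nV ^ 2 * Y ^ 2) := by
      rw [show (4 * |gt| * Λ * Gmax * γ * (nV * Y)) ^ 2 = 16 * |gt| ^ 2 * Λ ^ 2 * Gmax ^ 2 * γ ^ 2 * nV ^ 2 * Y ^ 2 by ring,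
        sq_abs]; ring
    have e2 : 2 * ε * lam * Gmin * nV ^ 2 * (β * Λ * Δ * Y ^ 2 / 2) = (Gmin * ε * lam * β * Δ) * (Λ * nV ^ 2 * Y ^ 2) := by
      ring
    rw [e1, e2]
    refine mul_le_mul_of_nonneg_right ?_ (mul_nonneg (mul_nonneg hΛ.le (sq_nonneg _)) (sq_nonneg _))
    have : 16 * Gmax ^ 2 * gt ^ 2 * Λ * γ ^ 2 ≤ 16 * Gmax ^ 2 * gT ^ 2 * Λ * γ ^ 2 := by
      have := mul_le_mul_of_nonneg_left hgt2 (by positivity : 0 ≤ 16 * Gmax ^ 2 * Λ * γ ^ 2)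
      linarith only [this]
    linarith only [this, hβ']
  -- AM–GM 2: defect forcing against the slack and the other half
  have hAG2 : 2 * (2 * β * cB * (nV * Y)) ≤ 2 * μ₀ * Gmin * nV ^ 2 + β * Λ * Δ * Y ^ 2 / 2 := by
    have hP : 0 ≤ 2 * μ₀ * Gmin * nV ^ 2 := mul_nonneg (mul_nonneg (mul_nonneg zero_le_two hμ₀0) hGmin.le) (sq_nonneg _)
    have hQ : 0 ≤ β * Λ * Δ * Y ^ 2 / 2 :=
      div_nonneg (mul_nonneg (mul_nonneg (mul_nonneg hβ hΛ.le) hΔ0.le) (sq_nonneg Y)) zero_le_two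
    have hsq : (2 * β * cB * (nV * Y)) ^ 2 ≤ 2 * μ₀ * Gmin * nV ^ 2 * (β * Λ * Δ * Y ^ 2 / 2) := by
      have e : 2 * μ₀ * Gmin * nV ^ 2 * (β * Λ * Δ * Y ^ 2 / 2) = (μ₀ * (Gmin * Λ * Δ)) * β * nV ^ 2 * Y ^ 2 := by ring
      rw [e, hμ₀cB]
      exact le_of_eq (by ring)
    exact two_mul_le_add_of_sq_le_mul hP hQ hsq
  -- the `F`-coefficient
  have hYcoef : -2 * Λ * Δ + 4 * Λ * gT ^ 2 * γ ^ 2 / Δ + 2 * ((1 - ε) * lam) ≤ -Λ * Δ := by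
    have h2 : Λ * (gT ^ 2 * (4 * γ ^ 2 / Δ) + 2 * lam / Λ) ≤ Λ * Δ := mul_le_mul_of_nonneg_left hsmall hΛ.le
    have e : Λ * (gT ^ 2 * (4 * γ ^ 2 / Δ) + 2 * lam / Λ) = 4 * Λ * gT ^ 2 * γ ^ 2 / Δ + 2 * lam := by
      rw [mul_add, ← mul_div_assoc Λ (2 * lam) Λ, mul_div_cancel_left₀ _ hΛ.ne']
      ring
    have h3 : 2 * ((1 - ε) * lam) ≤ 2 * lam := by
      have := mul_le_mul_of_nonneg_right (show 1 - ε ≤ 1 by linarith only [hε]) hlam; linarith only [this]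
    linarith only [h2, e, h3]
  -- rewrite the goal in terms of the named quantities
  have hβF : 0 ≤ β * (F₁ + F₂) := by positivity
  rw [← hSdef, ← hF₁def, ← hF₂def, ← hμ₀def, ← hV₁def, ← hV₂def]
  rw [hYsq] at hAG1 hAG2
  have hfast' := mul_le_mul_of_nonneg_left (add_le_add hfast₁' hfast₂') hβ
  have hY3 := mul_le_mul_of_nonneg_left hYcoef hβF
  have hμS : μ₀ * (Gmin * nV ^ 2) ≤ μ₀ * S := mul_le_mul_of_nonneg_left hSn hμ₀0
  have hεS : ε * lam * (Gmin * nV ^ 2) ≤ ε * lam * S := mul_le_mul_of_nonneg_left hSn (by positivity)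
  have hcross1 := mul_le_mul_of_nonneg_left hVY (by positivity : 0 ≤ 4 * |gt| * Λ * Gmax * γ)
  have hcross2 := mul_le_mul_of_nonneg_left hVYcB (by positivity : 0 ≤ 4 * β * cB)
  have hμF : 0 ≤ μ₀ * (β * (F₁ + F₂)) := mul_nonneg hμ₀0 hβF
  have hd0F : 0 ≤ Λ * d 0 * (β * (F₁ + F₂)) := by positivity
  have e1 : β * (-2 * Λ * (d 0 + Δ) * F₁ + 4 * (V₁ * Y₁ * cB) + 4 * (Λ * gT ^ 2 * γ ^ 2 * F₁ / Δ) +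
      (-2 * Λ * (d 0 + Δ) * F₂ + 4 * (V₂ * Y₂ * cB) + 4 * (Λ * gT ^ 2 * γ ^ 2 * F₂ / Δ))) =
      -2 * Λ * (d 0 + Δ) * (β * (F₁ + F₂)) + 4 * β * cB * (V₁ * Y₁ + V₂ * Y₂) +
        β * (F₁ + F₂) * (4 * Λ * gT ^ 2 * γ ^ 2 / Δ) := by ring
  have e2 : β * (F₁ + F₂) * (-2 * Λ * Δ + 4 * Λ * gT ^ 2 * γ ^ 2 / Δ + 2 * ((1 - ε) * lam)) =
      -2 * Λ * Δ * (β * (F₁ + F₂)) + β * (F₁ + F₂) * (4 * Λ * gT ^ 2 * γ ^ 2 / Δ) +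
        2 * ((1 - ε) * lam) * (β * (F₁ + F₂)) := by ring
  obtain ⟨Dv, hDv⟩ : ∃ Dv : ℝ, Dv = β * (F₁ + F₂) * (4 * Λ * gT ^ 2 * γ ^ 2 / Δ) := ⟨_, rfl⟩
  rw [← hDv] at e1 e2
  have st1 : (2 * (Λ * (d 0 + gt ^ 2 * σ₁) - lam) * a) * V₁ ^ 2 +
        (2 * (Λ * (d 0 + gt ^ 2 * σ₂) - lam) * b) * V₂ ^ 2 +
        2 * ((((Λ * (d 0 + gt ^ 2 * σ₁) + Λ * (d 0 + gt ^ 2 * σ₂) - 2 * lam : ℝ) : ℂ) * c) * conj (x₁ 0) * x₂ 0).re +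
      (a * (2 * (Fv₁ 0 * conj (x₁ 0)).re) + b * (2 * (Fv₂ 0 * conj (x₂ 0)).re) +
        2 * (c * conj (Fv₁ 0) * x₂ 0 + c * conj (x₁ 0) * Fv₂ 0).re) ≤
      -2 * lam * S + (2 * ε * lam * S + β * Λ * Δ * (F₁ + F₂) / 2) := by
    linarith only [hslow, hcross1, hAG1, hεS]
  have st2 : β * (∑ J ∈ W.erase 0,
          2 * ((Fv₁ J - ((hd₁ J : ℂ) * x₁ 0 + (hf₁ J : ℂ) * Fv₁ 0)) * conj (x₁ J - (hf₁ J : ℂ) * x₁ 0)).re +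
        ∑ J ∈ W.erase 0,
          2 * ((Fv₂ J - ((hd₂ J : ℂ) * x₂ 0 + (hf₂ J : ℂ) * Fv₂ 0)) * conj (x₂ J - (hf₂ J : ℂ) * x₂ 0)).re) ≤
      -2 * Λ * (d 0 + Δ) * (β * (F₁ + F₂)) + (2 * μ₀ * S + β * Λ * Δ * (F₁ + F₂) / 2) + Dv := by
    linarith only [hfast', e1, hcross2, hAG2, hμS]
  have st3 : Dv + 2 * ((1 - ε) * lam) * (β * (F₁ + F₂)) ≤ -(Λ * Δ) * (β * (F₁ + F₂)) + 2 * Λ * Δ * (β * (F₁ + F₂)) := by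
    linarith only [hY3, e2]
  linarith only [st1, st2, st3, hd0F, hμF]

end

end Summit.AnomalousDissipation.AnomalousDissipation.Theorems.SolenoidalFractalHomogenisation.RealisedQuasiStaticCellLaw
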